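import Summits.HubbardSuperconductivity.HubbardLadder.R3R4Props
import HarnessLib

/-!
# Finite torus: the pair sum rule `Σ_r P̄_d(L, r; ψ) = L² · p_d(L; ψ) ≥ 0`, for EVERY state — the off-diagonal pair correlations cannot all be strongly negative

HONEST FRAMING: first certified bounds; not a superconductivity verdict; every number certified or labelled float.
Speedrun `mbsolver`, seat sr-mbsolver-m3-5 (R-M3-2 row owner of the `pair_dd` rows), gen 4.
Theorem-only; no definition of a claim node, no named fact; zero compute.

The point.  On the `L × L` torus, for EVERY Fock vector `ψ`, summing the translation-averaged `d`-wave pair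
correlator `P̄_d(L, r; ψ) = avgPairCorr L r ψ` over one fundamental domain of displacements `r ∈ halfOpenBox 2 L`
gives `L²` times the pair-field density `p_d(L; ψ) = pairFieldDensity L ψ = L⁻⁴ Re ⟨ψ, Δ† Δ ψ⟩ ≥ 0`
(`sum_halfOpenBox_avgPairCorr`; bilinearity `⟨Δ†Δ⟩ = Σ_{x,y} ⟨Δ_x† Δ_y⟩` is the tree's
`expect_pairField_conjTranspose_mul_holds`, the displacement sum is re-indexed on the torus group).  Hence
(`sum_halfOpenBox_avgPairCorr_nonneg`) the r-sum is `≥ 0` for every state — the speedrun's engine word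
`S_d = Σ_r P̄_d(r) = L² p_d ≥ 0` (`HOME/sr-mbsolver-m3-5/PAIRING-BOUNDS.md` §1 B3) — and the sum over the
NON-ZERO displacements is `≥ -P̄_d(L, 0; ψ)` (`sum_erase_zero_avgPairCorr_ge`): together with a certified diagonal
ceiling `P̄_d(L, 0; ·) ≤ u` on the sector ground states (`HubbardLadder.PairCorrWindowCert` at `r = 0`) every
such ground state has `Σ_{r ≠ 0} P̄_d(L, r; ψ) ≥ -u` (`sum_erase_zero_avgPairCorr_ge_of_diagCert`), a DERIVED
floor complementing the per-`r` boxes `[-u, u]` of `Rows/TorusPairDiagDominance.lean`.  HONEST LABEL: kinematic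
transfers (positivity + bilinearity); no number here; informative only relative to sr-mbsolver-m3-2's certified
kinematic ranges, which the cell files grade against before using the word 'non-trivial'.
References: D. J. Scalapino, Phys. Rep. 250 (1995) 329, §2 eq. (2.2)–(2.4) (pair field and its two-point function);
C. N. Yang, Rev. Mod. Phys. 34 (1962) 694, §3–§4 (positivity of `⟨Δ†Δ⟩`); S. Friedli, Y. Velenik, Statistical
Mechanics of Lattice Systems (2017), §3.1–§3.2 (torus / fundamental domain). Folklore otherwise.
-/

namespace Summit.Ventures.CertifiedManyBodySolver.TorusPair

open Matrix Finset Literature.Probability.LatticeModels Literature.MathematicalPhysics.QuantumLattice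
  Summit.HubbardSuperconductivity.HubbardLadder
open scoped ComplexOrder BigOperators

noncomputable section

/-! ## §1 The sum rule -/

section SumRule

/-- **Pair sum rule on the finite torus, every state:** `Σ_{r ∈ halfOpenBox 2 L} P̄_d(L, r; ψ) = L² · p_d(L; ψ)`.
Scalapino, Phys. Rep. 250 (1995) 329, §2 eq. (2.4); Friedli–Velenik (2017) §3.2. [folklore] -/
theorem sum_halfOpenBox_avgPairCorr (L : ℕ) (ψ : Fock (Orb (FermionTorus 2 L))) :
    ∑ r ∈ halfOpenBox 2 L, avgPairCorr L r ψ = (L : ℝ) ^ 2 * pairFieldDensity L ψ := by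
  cases L with
  | zero => simp [avgPairCorr, pairFieldDensity]
  | succ L =>
    simp only [avgPairCorr, pairFieldDensity]
    rw [← sum_div, sum_halfOpenBox_torusProj (L + 1) (fun r' : TorusSite 2 (L + 1) =>
      ∑ x : TorusSite 2 (L + 1), (expect ((localPair dWaveFormFactor (L + 1) x)ᴴ *
        localPair dWaveFormFactor (L + 1) (x + r')) ψ).re), sum_comm]
    have hre : ∀ x : TorusSite 2 (L + 1),
        ∑ r' : TorusSite 2 (L + 1), (expect ((localPair dWaveFormFactor (L + 1) x)ᴴ *
            localPair dWaveFormFactor (L + 1) (x + r')) ψ).re =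
          ∑ y : TorusSite 2 (L + 1), (expect ((localPair dWaveFormFactor (L + 1) x)ᴴ *
            localPair dWaveFormFactor (L + 1) y) ψ).re := fun x =>
      Fintype.sum_equiv (Equiv.addLeft x) _ _ fun _ => rfl
    simp only [hre]
    rw [expect_pairField_conjTranspose_mul_holds dWaveFormFactor (L + 1) ψ, Complex.re_sum]
    simp only [Complex.re_sum]
    have hL : ((L + 1 : ℕ) : ℝ) ≠ 0 := by positivity
    field_simp

/-- **`Σ_{r ∈ halfOpenBox 2 L} P̄_d(L, r; ψ) ≥ 0`** for every state (`p_d ≥ 0`, `pairFieldDensity_nonneg`).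
Yang, Rev. Mod. Phys. 34 (1962) 694, §3. [folklore] -/
theorem sum_halfOpenBox_avgPairCorr_nonneg (L : ℕ) (ψ : Fock (Orb (FermionTorus 2 L))) :
    0 ≤ ∑ r ∈ halfOpenBox 2 L, avgPairCorr L r ψ := by
  rw [sum_halfOpenBox_avgPairCorr]
  exact mul_nonneg (by positivity) (pairFieldDensity_nonneg L ψ)

/-- `0 ∈ halfOpenBox 2 L` for `L ≥ 1`. Friedli–Velenik (2017) §3.2. [folklore] -/
theorem zero_mem_halfOpenBox_of_pos {L : ℕ} (hL : 0 < L) : (0 : Site 2) ∈ halfOpenBox 2 L := by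
  rw [mem_halfOpenBox]
  intro i
  exact ⟨le_rfl, by simpa using hL⟩

/-- **The off-diagonal displacements cannot all be strongly negative:**
`Σ_{r ∈ halfOpenBox 2 L, r ≠ 0} P̄_d(L, r; ψ) ≥ -P̄_d(L, 0; ψ)` for every state and every side `L ≥ 1`.
Scalapino (1995) §2; Yang (1962) §3. [folklore] -/
theorem sum_erase_zero_avgPairCorr_ge {L : ℕ} (hL : 0 < L) (ψ : Fock (Orb (FermionTorus 2 L))) :
    -avgPairCorr L 0 ψ ≤ ∑ r ∈ (halfOpenBox 2 L).erase 0, avgPairCorr L r ψ := by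
  have h := sum_halfOpenBox_avgPairCorr_nonneg L ψ
  rw [← add_sum_erase _ _ (zero_mem_halfOpenBox_of_pos hL)] at h
  linarith

end SumRule

/-! ## §2 Row grammar: a certified diagonal ceiling floors the off-diagonal sum -/

section Rows

variable {H : TorusHamiltonianFamily} {N : ℕ → ℕ} {L : ℕ}

/-- **DERIVED floor from one diagonal row.** A certified window for `P̄_d(L, 0; ·)` over the normalised
`(N L, S^z = 0)` sector ground states of `H L` with upper end `u = c.hi` gives, on the same states,
`Σ_{r ∈ halfOpenBox 2 L, r ≠ 0} P̄_d(L, r; ψ) ≥ -u` (`L ≥ 1`). HONEST FRAMING: first certified bounds; not a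
superconductivity verdict; every number certified or labelled float. Scalapino (1995) §2; Qin et al. (2020) §II. [folklore] -/
theorem sum_erase_zero_avgPairCorr_ge_of_diagCert (hL : 0 < L) (c : PairCorrWindowCert H N L 0)
    (ψ : Fock (Orb (FermionTorus 2 L))) (h1 : star ψ ⬝ᵥ ψ = 1)
    (hgs : IsGroundStateInSector (H L) (N L) 0 ψ) :
    -c.hi ≤ ∑ r ∈ (halfOpenBox 2 L).erase 0, avgPairCorr L r ψ :=
  (neg_le_neg (c.sound ψ h1 hgs).2).trans (sum_erase_zero_avgPairCorr_ge hL ψ)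

/-- **Two-sided DERIVED window for the off-diagonal sum** from a diagonal window `[ℓ, u]` (`ℓ = c.lo`, `u = c.hi`)
and any certified ceiling `s` on the full r-sum `Σ_{r ∈ halfOpenBox 2 L} P̄_d(L, r; ·) = L² p_d` (the speedrun's
`S_d` ceiling, hypothesis `hs`): `-u ≤ Σ_{r ≠ 0} P̄_d(L, r; ψ) ≤ s - ℓ`. HONEST FRAMING as above. [folklore] -/
theorem sum_erase_zero_avgPairCorr_mem_Icc_of_diagCert (hL : 0 < L) (c : PairCorrWindowCert H N L 0) {s : ℝ}
    (ψ : Fock (Orb (FermionTorus 2 L))) (h1 : star ψ ⬝ᵥ ψ = 1)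
    (hgs : IsGroundStateInSector (H L) (N L) 0 ψ)
    (hs : ∑ r ∈ halfOpenBox 2 L, avgPairCorr L r ψ ≤ s) :
    ∑ r ∈ (halfOpenBox 2 L).erase 0, avgPairCorr L r ψ ∈ Set.Icc (-c.hi) (s - c.lo) := by
  refine ⟨sum_erase_zero_avgPairCorr_ge_of_diagCert hL c ψ h1 hgs, ?_⟩
  have hlo := (c.sound ψ h1 hgs).1
  rw [← add_sum_erase _ _ (zero_mem_halfOpenBox_of_pos hL)] at hs
  linarith

end Rows

end

end Summit.Ventures.CertifiedManyBodySolver.TorusPair
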